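import Mathlib
import Summits.NavierStokesRegularity.NavierStokesRegularity.Theorems.LevelSetModerationHighSpeedPressureWorkLateBookkeeping
import Summits.NavierStokesRegularity.NavierStokesRegularity.Theorems.LevelSetModerationHighSpeedPressureWorkDyadicExtinction
import Summits.NavierStokesRegularity.NavierStokesRegularity.Theorems.LevelSetModerationHighSpeedPressureWorkIsoSpeedStubs
import Summits.NavierStokesRegularity.NavierStokesRegularity.Theorems.LevelSetModerationHighSpeedPressureWorkConsequences
import Summits.NavierStokesRegularity.NavierStokesRegularity.Theorems.LevelSetModerationLevelSetEnergyInequality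

/-!
# Route LevelSetModeration — `HighSpeedPressureWork` with threshold `4B₀` is exactly class-uniform boundedness

Support file for item stmt-NavierStokesRegularity-18149 (`HighSpeedPressureWork`, the crux of the
route). Write `crux₄` for the crux with the window condition `2B₀ ≤ M` replaced by `4B₀ ≤ M`
(levels `c ≥ 2B₀` instead of `c ≥ B₀`), and `UniformBound` for the class-uniform a priori speed
bound: for all `ν, T > 0` and data bounds `(E₀, B₀)` there is `G` with `|u| ≤ G` on
`[0,T) × ℝ³` for every classical Leray–Hopf solution from a rapidly decaying datum with
`∫|u₀|² ≤ E₀`, `|u₀| ≤ B₀` — quantitative regularity of the data class. This file certifies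

* `HighSpeedPressureWork → crux₄` (trivial: fewer windows);
* `crux₄ → UniformBound` (`levelSetModeration_uniformBound_of_highSpeedPressureWorkFour`):
  per solution, the pairing bound on the windows `M ≥ 4B₁` (`B₁ = max(B₀,1)`) gives, through the
  level-set energy inequality (item `LevelSetEnergyInequality`, proved) and Cauchy–Schwarz, the
  iso-speed area law `ν 𝒟¹_c ≤ √(F⁺ M^m) V_c` on those windows; the linear level recursion
  (`stub_linearLevelRecursion`), the occupation quantum (`stub_occupationQuantum`) and the area-law
  closure by dyadic extinction (`stub_areaLawClosure`, applied with datum bound `2B₁`) then bound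
  the solution class-uniformly;
* `UniformBound → crux₄` (`levelSetModeration_highSpeedPressureWorkFour_of_uniformBound`): the
  bookkeeping above the threshold (`levelSetModeration_bookkeepingAboveThreshold`: early window
  empty above `2B₀`, pointwise pressure bound after the smoothing delay, slice integration by
  parts), with exponent `m = 0`;
* hence `crux₄ ↔ UniformBound` (`levelSetModeration_highSpeedPressureWorkFour_iff_uniformBound`),
  and `crux₄` still closes the route: `crux₄ → BoundedToClay → NavierStokesRegularity`
  (`levelSetModeration_navierStokes_of_highSpeedPressureWorkFour`).

Reading for the planner (D-0014): restated with threshold `4B₀` — at no cost for the route — the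
crux IS class-uniform boundedness (quantitative regularity of the class `(ν, T, E₀, B₀)`), no more
and no less; the product form, the moderation freedom and the exponent `m < 10/3` carry no further
content, and the bounded-strength debt L3 disappears (its residue, the level window `[B₀, 2B₀)`
during the early time window, is an artefact of the threshold `2B₀`).
-/

noncomputable section

-- single-conjunct summit: `Summit.<Summit>.<Problem>` repeats the name by the D-0017 layout
set_option linter.dupNamespace false

namespace Summit.NavierStokesRegularity.NavierStokesRegularity.Theorems

open MeasureTheory Set Filter Topology Function
open scoped ENNReal
open Literature.Analysis.FluidPDE
open Summit.NavierStokesRegularity.NavierStokesRegularity.Theses.LevelSetModeration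

/-! ### Cauchy–Schwarz: the area law from the speed-gradient bound -/

/-- From `ν √D ≤ √(Λ M^m V)` and `𝒜 ≤ V^{1/2} D^{1/2}` (finite `V, D`, `M > 0`):
`ν 𝒜 ≤ √(Λ⁺) M^{m/2} V` (all as `toReal`). [folklore] -/
theorem levelSetModeration_areaLaw_of_sqrtBound {ν Λ M m : ℝ} {V D A : ℝ≥0∞} (hν : 0 < ν)
    (hM : 0 < M) (hVfin : V ≠ ⊤) (hDfin : D ≠ ⊤)
    (hCS : A ≤ V ^ (1 / 2 : ℝ) * D ^ (1 / 2 : ℝ))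
    (h : ν * Real.sqrt D.toReal ≤ Real.sqrt (Λ * M ^ m * V.toReal)) :
    ν * A.toReal ≤ Real.sqrt (max Λ 0) * M ^ (m / 2) * V.toReal := by
  have hCSr : A.toReal ≤ Real.sqrt V.toReal * Real.sqrt D.toReal := by
    have h1 := ENNReal.toReal_mono (ENNReal.mul_ne_top
      (ENNReal.rpow_ne_top_of_nonneg (by norm_num) hVfin)
      (ENNReal.rpow_ne_top_of_nonneg (by norm_num) hDfin)) hCS
    rwa [ENNReal.toReal_mul, ← ENNReal.toReal_rpow, ← ENNReal.toReal_rpow, ← Real.sqrt_eq_rpow,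
      ← Real.sqrt_eq_rpow] at h1
  have hV0 : 0 ≤ V.toReal := ENNReal.toReal_nonneg
  have hMm : 0 ≤ M ^ m := Real.rpow_nonneg hM.le m
  have h' : ν * Real.sqrt D.toReal ≤ Real.sqrt (max Λ 0 * M ^ m * V.toReal) := by
    refine h.trans (Real.sqrt_le_sqrt ?_)
    gcongr
    exact le_max_left _ _
  calc ν * A.toReal ≤ ν * (Real.sqrt V.toReal * Real.sqrt D.toReal) :=
        mul_le_mul_of_nonneg_left hCSr hν.le
    _ = Real.sqrt V.toReal * (ν * Real.sqrt D.toReal) := by ring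
    _ ≤ Real.sqrt V.toReal * Real.sqrt (max Λ 0 * M ^ m * V.toReal) := by gcongr
    _ = Real.sqrt (max Λ 0) * M ^ (m / 2) * V.toReal := by
        rw [Real.sqrt_mul (by positivity), Real.sqrt_mul (le_max_right _ _),
          Real.sqrt_eq_rpow (M ^ m), ← Real.rpow_mul hM.le]
        have : m * (1 / 2) = m / 2 := by ring
        rw [this]
        have hsq : Real.sqrt V.toReal * Real.sqrt V.toReal = V.toReal := Real.mul_self_sqrt hV0
        calc Real.sqrt V.toReal * (Real.sqrt (max Λ 0) * M ^ (m / 2) * Real.sqrt V.toReal)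
            = Real.sqrt (max Λ 0) * M ^ (m / 2) * (Real.sqrt V.toReal * Real.sqrt V.toReal) := by
              ring
          _ = Real.sqrt (max Λ 0) * M ^ (m / 2) * V.toReal := by rw [hsq]

/-! ### `HighSpeedPressureWork → crux₄` -/

/-- The crux implies its restriction to the windows `M ≥ 4B₀` (a datum bound is nonnegative as
soon as the class is nonempty). [folklore] -/
theorem levelSetModeration_highSpeedPressureWorkFour_of_highSpeedPressureWork :
    HighSpeedPressureWork → (∀ (ν T : ℝ), 0 < ν → 0 < T → ∃ m : ℝ, m < 10 / 3 ∧ ∃ F : ℝ → ℝ → ℝ, ∀ (u : ℝ → EuclideanSpace ℝ (Fin 3) → EuclideanSpace ℝ (Fin 3)) (p : ℝ → EuclideanSpace ℝ (Fin 3) → ℝ), Literature.Analysis.FluidPDE.IsClassicalNSSolutionOn (Set.Ico 0 T) ν 0 u p → Literature.Analysis.FluidPDE.IsLerayHopfOn T ν 0 (u 0) u → Literature.Analysis.FluidPDE.HasRapidSpatialDecay (u 0) → ∀ (E₀ B₀ : ℝ), (∫ x, ‖u 0 x‖ ^ 2) ≤ E₀ → (∀ x, ‖u 0 x‖ ≤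 B₀) → ∀ (M c t : ℝ), 4 * B₀ ≤ M → M / 2 ≤ c → c ≤ M → 0 < c → t ∈ Set.Ico 0 T → -(∫ τ in Set.Ioo 0 t, ∫ x, max (1 - c / ‖u τ x‖) 0 * (fderiv ℝ (Literature.Analysis.FluidPDE.normalisedPressure (u τ)) x (u τ x))) ≤ Real.sqrt (F E₀ B₀ * M ^ m * (∫⁻ τ in Set.Ioo 0 T, MeasureTheory.volume {x | c < ‖u τ x‖}).toReal) * Real.sqrt ((∫⁻ τ in Set.Ioo 0 T, ∫⁻ x, Set.indicator {x | c < ‖u τ x‖} (fun x => ENNReal.ofReal (‖fderiv ℝ (fun y => ‖u τ y‖) x‖ ^ 2)) x).toReal)) := by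
  intro h ν T hν hT
  obtain ⟨m, hm, F, hF⟩ := h ν T hν hT
  refine ⟨m, hm, F, ?_⟩
  intro u p hcl hLH hdec E₀ B₀ hE hB M c t hM hMc hcM hc ht
  have hB0 : 0 ≤ B₀ := (norm_nonneg _).trans (hB 0)
  exact hF u p hcl hLH hdec E₀ B₀ hE hB M c t (by linarith) hMc hcM hc ht

/-! ### `crux₄ → UniformBound` -/

/-- **`crux₄` implies the class-uniform speed bound.** Per solution: the pairing bound on the
windows `M ≥ 4B₁`, `B₁ = max(B₀,1)`, gives through the level-set energy inequality
(`levelSetModeration_levelSetEnergyInequality_proof`) `ν √D_c ≤ √(F M^m V_c)`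
(`levelSetEnergy_le_of_pairingBound`), hence the area law `ν 𝒟¹_c ≤ √(F⁺) M^{m/2} V_c`
(`levelSetModeration_isoSpeedArea_le_sqrt`, `levelSetModeration_areaLaw_of_sqrtBound`); with the
linear level recursion (`stub_linearLevelRecursion`) and the occupation quantum
(`stub_occupationQuantum`) the dyadic-extinction closure (`stub_areaLawClosure`, datum bound `2B₁`)
bounds the solution by a constant depending on `(ν, T, E₀, B₀)` only. [folklore] -/
theorem levelSetModeration_uniformBound_of_highSpeedPressureWorkFour :
    (∀ (ν T : ℝ), 0 < ν → 0 < T → ∃ m : ℝ, m < 10 / 3 ∧ ∃ F : ℝ → ℝ → ℝ, ∀ (u : ℝ → EuclideanSpace ℝ (Fin 3) → EuclideanSpace ℝ (Fin 3)) (p : ℝ → EuclideanSpace ℝ (Fin 3) → ℝ), Literature.Analysis.FluidPDE.IsClassicalNSSolutionOn (Set.Ico 0 T) ν 0 u p → Literature.Analysis.FluidPDE.IsLerayHopfOn T ν 0 (u 0) u → Literature.Analysis.FluidPDE.HasRapidSpatialDecay (u 0) → ∀ (E₀ B₀ : ℝ), (∫ x, ‖u 0 x‖ ^ 2) ≤ E₀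 → (∀ x, ‖u 0 x‖ ≤ B₀) → ∀ (M c t : ℝ), 4 * B₀ ≤ M → M / 2 ≤ c → c ≤ M → 0 < c → t ∈ Set.Ico 0 T → -(∫ τ in Set.Ioo 0 t, ∫ x, max (1 - c / ‖u τ x‖) 0 * (fderiv ℝ (Literature.Analysis.FluidPDE.normalisedPressure (u τ)) x (u τ x))) ≤ Real.sqrt (F E₀ B₀ * M ^ m * (∫⁻ τ in Set.Ioo 0 T, MeasureTheory.volume {x | c < ‖u τ x‖}).toReal) * Real.sqrt ((∫⁻ τ in Set.Ioo 0 T, ∫⁻ x, Set.indicator {x | c < ‖u τ x‖} (fun x => ENNReal.ofReal (‖fderiv ℝ (fun y => ‖u τ y‖) x‖ ^ 2)) x).toReal)) → (∀ (ν T : ℝ), 0 < ν → 0 < T → ∀ (E₀ B₀ : ℝ), ∃ G : ℝ, ∀ (u : ℝ → EuclideanSpace ℝ (Fin 3) → EuclideanSpace ℝ (Fin 3)) (p : ℝ → EuclideanSpace ℝ (Fin 3) → ℝ), Literature.Analysis.FluidPDE.IsClassicalNSSolutionOn (Set.Ico 0 T) ν 0 u p → Literature.Analysis.FluidPDE.IsLerayHopfOn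 T ν 0 (u 0) u → Literature.Analysis.FluidPDE.HasRapidSpatialDecay (u 0) → (∫ x, ‖u 0 x‖ ^ 2) ≤ E₀ → (∀ x, ‖u 0 x‖ ≤ B₀) → ∀ t ∈ Set.Ico 0 T, ∀ x, ‖u t x‖ ≤ G) := by
  intro h4 ν T hν hT E₀ B₀
  obtain ⟨m, hm, F, hF⟩ := h4 ν T hν hT
  obtain ⟨C, hC, hrec⟩ := stub_linearLevelRecursion
  obtain ⟨κ, A₀, hκ, hA₀, hq⟩ := stub_occupationQuantum
  set B₁ : ℝ := max B₀ 1 with hB₁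
  have hB₁pos : 0 < B₁ := lt_of_lt_of_le one_pos (le_max_right _ _)
  have hm₁ : m / 2 < 5 / 3 := by linarith
  obtain ⟨G, hG⟩ := stub_areaLawClosure ν T (m / 2) (Real.sqrt (max (F E₀ B₁) 0)) E₀ (2 * B₁)
    C κ A₀ hν hT hm₁ hC hκ hA₀
  refine ⟨G, fun u p hcl hLH hdec hE hB => hG u p hcl hLH hdec hE ?_ ?_ ?_ ?_⟩
  · intro x
    exact (hB x).trans ((le_max_left _ _).trans (by linarith))
  · intro c hc
    exact hrec ν T u p hν hT hcl hLH hdec E₀ c hE hc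
  · intro B' hB' hbd' T' G' hT' hG' hbd hpt
    exact hq ν T u p hν hT hcl hLH hdec B' hB' hbd' T' G' hT' hG' hbd hpt
  · -- the area law on the windows `M ≥ 4B₁` from the pairing bound of `crux₄`
    intro M c hM hMc hcM hc
    have hMpos : 0 < M := by linarith
    have hB₁' : ∀ x, ‖u 0 x‖ ≤ B₁ := fun x => (hB x).trans (le_max_left _ _)
    have hu0 : ∀ x, ‖u 0 x‖ ≤ 4 * B₁ / 2 := fun x => (hB₁' x).trans (by linarith)
    have hPW : ∀ (M' c' t : ℝ), 4 * B₁ ≤ M' → M' / 2 ≤ c' → c' ≤ M' → 0 < c' → t ∈ Ico 0 T →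
        -(∫ τ in Ioo 0 t, ∫ x, max (1 - c' / ‖u τ x‖) 0 *
            (fderiv ℝ (normalisedPressure (u τ)) x (u τ x))) ≤
          Real.sqrt (F E₀ B₁ * M' ^ m * (∫⁻ τ in Ioo 0 T, volume {x | c' < ‖u τ x‖}).toReal) *
          Real.sqrt ((∫⁻ τ in Ioo 0 T, ∫⁻ x, Set.indicator {x | c' < ‖u τ x‖}
            (fun x => ENNReal.ofReal (‖fderiv ℝ (fun y => ‖u τ y‖) x‖ ^ 2)) x).toReal) :=
      fun M' c' t hM' hMc' hcM' hc' ht => hF u p hcl hLH hdec E₀ B₁ hE hB₁' M' c' t hM' hMc' hcM' hc' ht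
    have hM4 : 4 * B₁ ≤ M := by linarith
    obtain ⟨hsqrt, -, -⟩ := levelSetEnergy_le_of_pairingBound
      levelSetModeration_levelSetEnergyInequality_proof hν hT hcl hLH hdec (M₀ := 4 * B₁) hu0 hPW
      hM4 hMc hcM hc
    -- finiteness and Cauchy–Schwarz
    have hVfin : (∫⁻ τ in Ioo 0 T, volume {x | c < ‖u τ x‖}) ≠ ⊤ :=
      ne_top_of_le_ne_top ENNReal.ofReal_ne_top (levelSetVolume_le hLH hν.le hT.le hc)
    have hDfin := (levelSetDissipation_ne_top hcl hLH hT hν.le hc.le).1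
    have hCS := levelSetModeration_isoSpeedArea_le_sqrt hcl.smooth_velocity hc (T := T)
    exact levelSetModeration_areaLaw_of_sqrtBound hν hMpos hVfin hDfin hCS hsqrt

/-! ### `UniformBound → crux₄` -/

/-- **The class-uniform speed bound implies `crux₄`**, with exponent `m = 0`: this is the
bookkeeping above the threshold (`levelSetModeration_bookkeepingAboveThreshold`). [folklore] -/
theorem levelSetModeration_highSpeedPressureWorkFour_of_uniformBound :
    (∀ (ν T : ℝ), 0 < ν → 0 < T → ∀ (E₀ B₀ : ℝ), ∃ G : ℝ, ∀ (u : ℝ → EuclideanSpace ℝ (Fin 3) → EuclideanSpace ℝ (Fin 3)) (p : ℝ → EuclideanSpace ℝ (Fin 3) → ℝ), Literature.Analysis.FluidPDE.IsClassicalNSSolutionOn (Set.Ico 0 T) ν 0 u p → Literature.Analysis.FluidPDE.IsLerayHopfOn T ν 0 (u 0) u → Literature.Analysis.FluidPDE.HasRapidSpatialDecay (u 0) → (∫ x, ‖u 0 x‖ ^ 2) ≤ E₀ → (∀ x, ‖u 0 x‖ ≤ B₀) → ∀ t ∈ Set.Ico 0 T, ∀ x, ‖u t x‖ ≤ G) →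 (∀ (ν T : ℝ), 0 < ν → 0 < T → ∃ m : ℝ, m < 10 / 3 ∧ ∃ F : ℝ → ℝ → ℝ, ∀ (u : ℝ → EuclideanSpace ℝ (Fin 3) → EuclideanSpace ℝ (Fin 3)) (p : ℝ → EuclideanSpace ℝ (Fin 3) → ℝ), Literature.Analysis.FluidPDE.IsClassicalNSSolutionOn (Set.Ico 0 T) ν 0 u p → Literature.Analysis.FluidPDE.IsLerayHopfOn T ν 0 (u 0) u → Literature.Analysis.FluidPDE.HasRapidSpatialDecay (u 0) → ∀ (E₀ B₀ : ℝ), (∫ x, ‖u 0 x‖ ^ 2) ≤ E₀ → (∀ x, ‖u 0 x‖ ≤ B₀) → ∀ (M c t : ℝ), 4 * B₀ ≤ M → M / 2 ≤ c → c ≤ M → 0 < c → t ∈ Set.Ico 0 T → -(∫ τ in Set.Ioo 0 t, ∫ x, max (1 - c / ‖u τ x‖) 0 * (fderiv ℝ (Literature.Analysis.FluidPDE.normalisedPressure (u τ)) x (u τ x))) ≤ Real.sqrt (F E₀ B₀ * M ^ m * (∫⁻ τ in Set.Ioo 0 T, MeasureTheory.volume {x | c < ‖u τ x‖}).toReal)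 * Real.sqrt ((∫⁻ τ in Set.Ioo 0 T, ∫⁻ x, Set.indicator {x | c < ‖u τ x‖} (fun x => ENNReal.ofReal (‖fderiv ℝ (fun y => ‖u τ y‖) x‖ ^ 2)) x).toReal)) := by
  intro hU ν T hν hT
  choose G hG using fun E₀ B₀ => hU ν T hν hT E₀ B₀
  obtain ⟨F, hF⟩ := levelSetModeration_bookkeepingAboveThreshold ν T hν hT G
    (fun u p hcl hLH hdec E₀ B₀ hE hB => hG E₀ B₀ u p hcl hLH hdec hE hB)
  refine ⟨0, by norm_num, F, ?_⟩
  intro u p hcl hLH hdec E₀ B₀ hE hB M c t hM hMc hcM hc ht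
  rw [Real.rpow_zero, mul_one]
  exact hF u p hcl hLH hdec E₀ B₀ hE hB M c t hM hMc hcM hc ht

/-! ### The equivalence and the route -/

/-- **`crux₄ ↔ UniformBound`**: the crux of route `LevelSetModeration`, restated with the window
threshold `4B₀`, is EXACTLY the class-uniform a priori speed bound (quantitative regularity of the
data class `(ν, T, E₀, B₀)`). [folklore] -/
theorem levelSetModeration_highSpeedPressureWorkFour_iff_uniformBound :
    (∀ (ν T : ℝ), 0 < ν → 0 < T → ∃ m : ℝ, m < 10 / 3 ∧ ∃ F : ℝ → ℝ → ℝ, ∀ (u : ℝ → EuclideanSpace ℝ (Fin 3) → EuclideanSpace ℝ (Fin 3)) (p : ℝ → EuclideanSpace ℝ (Fin 3) → ℝ), Literature.Analysis.FluidPDE.IsClassicalNSSolutionOn (Set.Ico 0 T) ν 0 u p → Literature.Analysis.FluidPDE.IsLerayHopfOn T ν 0 (u 0) u → Literature.Analysis.FluidPDE.HasRapidSpatialDecay (u 0) → ∀ (E₀ B₀ : ℝ), (∫ x, ‖u 0 x‖ ^ 2) ≤ E₀ → (∀ x, ‖u 0 x‖ ≤ B₀) → ∀ (M c t : ℝ),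 4 * B₀ ≤ M → M / 2 ≤ c → c ≤ M → 0 < c → t ∈ Set.Ico 0 T → -(∫ τ in Set.Ioo 0 t, ∫ x, max (1 - c / ‖u τ x‖) 0 * (fderiv ℝ (Literature.Analysis.FluidPDE.normalisedPressure (u τ)) x (u τ x))) ≤ Real.sqrt (F E₀ B₀ * M ^ m * (∫⁻ τ in Set.Ioo 0 T, MeasureTheory.volume {x | c < ‖u τ x‖}).toReal) * Real.sqrt ((∫⁻ τ in Set.Ioo 0 T, ∫⁻ x, Set.indicator {x | c < ‖u τ x‖} (fun x => ENNReal.ofReal (‖fderiv ℝ (fun y => ‖u τ y‖) x‖ ^ 2)) x).toReal)) ↔ (∀ (ν T : ℝ), 0 < ν → 0 < T → ∀ (E₀ B₀ : ℝ), ∃ G : ℝ, ∀ (u : ℝ → EuclideanSpace ℝ (Fin 3) → EuclideanSpace ℝ (Fin 3)) (p : ℝ → EuclideanSpace ℝ (Fin 3) → ℝ), Literature.Analysis.FluidPDE.IsClassicalNSSolutionOn (Set.Ico 0 T) ν 0 u p → Literature.Analysis.FluidPDE.IsLerayHopfOn T ν 0 (u 0) u → Literature.Analysis.FluidPDE.HasRapidSpatialDecay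 (u 0) → (∫ x, ‖u 0 x‖ ^ 2) ≤ E₀ → (∀ x, ‖u 0 x‖ ≤ B₀) → ∀ t ∈ Set.Ico 0 T, ∀ x, ‖u t x‖ ≤ G) :=
  ⟨levelSetModeration_uniformBound_of_highSpeedPressureWorkFour,
    levelSetModeration_highSpeedPressureWorkFour_of_uniformBound⟩

/-- **`crux₄` still closes the route**: `crux₄ → BoundedToClay → NavierStokesRegularity`
(the uniform bound it yields is in particular a bound for each solution, which is the hypothesis
of the route's item `BoundedToClay`; the iteration item `LevelSetClosure` is not even needed).
[folklore] -/
theorem levelSetModeration_navierStokes_of_highSpeedPressureWorkFour :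
    (∀ (ν T : ℝ), 0 < ν → 0 < T → ∃ m : ℝ, m < 10 / 3 ∧ ∃ F : ℝ → ℝ → ℝ, ∀ (u : ℝ → EuclideanSpace ℝ (Fin 3) → EuclideanSpace ℝ (Fin 3)) (p : ℝ → EuclideanSpace ℝ (Fin 3) → ℝ), Literature.Analysis.FluidPDE.IsClassicalNSSolutionOn (Set.Ico 0 T) ν 0 u p → Literature.Analysis.FluidPDE.IsLerayHopfOn T ν 0 (u 0) u → Literature.Analysis.FluidPDE.HasRapidSpatialDecay (u 0) → ∀ (E₀ B₀ : ℝ), (∫ x, ‖u 0 x‖ ^ 2) ≤ E₀ → (∀ x, ‖u 0 x‖ ≤ B₀) → ∀ (M c t : ℝ), 4 * B₀ ≤ M → M / 2 ≤ c → c ≤ M → 0 < c → t ∈ Set.Ico 0 T → -(∫ τ in Set.Ioo 0 t, ∫ x, max (1 - c / ‖u τ x‖) 0 * (fderiv ℝ (Literature.Analysis.FluidPDE.normalisedPressure (u τ)) x (u τ x))) ≤ Real.sqrt (F E₀ B₀ * M ^ m * (∫⁻ τ in Set.Ioo 0 T, MeasureTheory.volume {x | c < ‖u τ x‖}).toReal)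 * Real.sqrt ((∫⁻ τ in Set.Ioo 0 T, ∫⁻ x, Set.indicator {x | c < ‖u τ x‖} (fun x => ENNReal.ofReal (‖fderiv ℝ (fun y => ‖u τ y‖) x‖ ^ 2)) x).toReal)) → BoundedToClay → _root_.NavierStokesRegularity := by
  intro h4 h₃
  refine h₃ ?_
  intro ν T hν hT u p hcl hLH hdec
  obtain ⟨C₀, hC₀⟩ := hdec 0 0
  have hB : ∀ x, ‖u 0 x‖ ≤ C₀ := fun x => by
    have h := hC₀ x
    rwa [pow_zero, one_mul, norm_iteratedFDeriv_zero] at h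
  obtain ⟨G, hG⟩ := levelSetModeration_uniformBound_of_highSpeedPressureWorkFour h4 ν T hν hT
    (∫ x, ‖u 0 x‖ ^ 2) C₀
  exact ⟨G, hG u p hcl hLH hdec le_rfl hB⟩

/-- In particular the crux as filed implies the class-uniform bound through `crux₄`
(a second certificate, next to `levelSetModeration_highSpeedPressureWork_iff_linearLaw_and_bookkeeping`,
that `HighSpeedPressureWork` is at least as strong as quantitative regularity). [folklore] -/
theorem levelSetModeration_uniformBound_of_highSpeedPressureWork' :
    HighSpeedPressureWork → (∀ (ν T : ℝ), 0 < ν → 0 < T → ∀ (E₀ B₀ : ℝ), ∃ G : ℝ, ∀ (u : ℝ → EuclideanSpace ℝ (Fin 3) → EuclideanSpace ℝ (Fin 3)) (p : ℝ → EuclideanSpace ℝ (Fin 3) → ℝ), Literature.Analysis.FluidPDE.IsClassicalNSSolutionOn (Set.Ico 0 T) ν 0 u p → Literature.Analysis.FluidPDE.IsLerayHopfOn T ν 0 (u 0) u → Literature.Analysis.FluidPDE.HasRapidSpatialDecay (u 0) → (∫ x, ‖u 0 x‖ ^ 2) ≤ E₀ → (∀ x, ‖u 0 x‖ ≤ B₀)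 → ∀ t ∈ Set.Ico 0 T, ∀ x, ‖u t x‖ ≤ G) :=
  fun h => levelSetModeration_uniformBound_of_highSpeedPressureWorkFour
    (levelSetModeration_highSpeedPressureWorkFour_of_highSpeedPressureWork h)

end Summit.NavierStokesRegularity.NavierStokesRegularity.Theorems

end
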